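import Literature.Geometry.Kaehler.ComplexTorusIntegralHodgeClassesPolarizationPowers
import Literature.Geometry.Kaehler.ComplexTorusDivisorClassesLowCodimension
import Literature.Geometry.Kaehler.ComplexTorusDivisorClassesEllipticProduct
import Literature.Geometry.Kaehler.ComplexTorusHardLefschetz
import HarnessLib

/-!
# The lattice `Dᵖ(X)_ℤ ⊆ Hdgᵖ(X, ℤ)` generated by the integral divisor monomials `E₁ ∧ ⋯ ∧ E_p` (`Eᵢ ∈ NS(X)`):
# `rk_ℤ Dᵖ(X)_ℤ = dim_ℚ Dᵖ(X)`, and `Dᵖ(X) = Bᵖ(X)` (Tate / Murty / Lange §7.3) holds IFF `Dᵖ(X)_ℤ` has FINITE INDEX in `Hdgᵖ(X, ℤ)`;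
# then one `n ≥ 1` multiplies every integral Hodge class into an integral combination of intersections of divisor classes

Layer `Literature/Geometry/Kaehler`, namespace `Literature.Geometry.Kaehler.ComplexTorus`; lane `lit-hodgefound` (Track 2
foundations library), seat p09, generation 31, row g31-#10. THEOREMS ONLY (0 definitions); no named fact, net debt 0. The INTEGRAL
reading of the tree's `Dᵖ(X)` theory (`ComplexTorusDivisorClasses`: `divisorClasses Φ p = span_ℚ {E₁ ∧ ⋯ ∧ E_p : Eᵢ ∈ NS(X)}`, Lange
2023 §7.3.1 "the subring `D•(X)` of `H^{2•}_Hodge(X)` generated by `H⁰_Hodge(X)` and `H²_Hodge(X)`"; the many `Dᵖ = H^{2p}_Hodge`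
theorems of the tree — Lefschetz `(1,1)` `divisorClasses_one_eq_hodgeClasses`, the `(n−1,n−1)` theorem
`divisorClasses_eq_hodgeClasses_of_finrank_eq_succ`, Tate's theorem for products of elliptic curves
`divisorClasses_eq_hodgeClasses_pi_ellipticPeriod` (van Geemen 1994 Thm. 4.3), dimension `≤ 3`
`divisorClasses_eq_hodgeClasses_of_isAbelianVariety_of_finrank_le_three`). The subgroup

  `Dᵖ(X)_ℤ := AddSubgroup.closure {E₁ ∧ ⋯ ∧ E_p : Eᵢ ∈ NS(X)} ⊆ H^{2p}(X, ℂ)`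

(written out, no definition) lies in `Hdgᵖ(X, ℤ) = H^{2p}(X, ℤ) ∩ H^{p,p}` (g31-#1 `wedgeFamily_ofRealForm_mem_integralHodgeClasses`; Voisin
§11.3.1 Def. 11.28 / Thm. 11.30: classes of divisors and their products are integral Hodge classes), its `ℚ`-span is `Dᵖ(X)`, its rank
is `dim_ℚ Dᵖ(X)` (a `ℤ`-basis of a subgroup of the lattice `H^{2p}(X, ℤ)` stays `ℚ`-free, Mathlib's `LinearIndependent.iff_fractionRing`),
and therefore (Mathlib's `Submodule.finiteQuotient_iff`):

  **`Dᵖ(X) = Bᵖ(X)` ⟺ `[Hdgᵖ(X, ℤ) : Dᵖ(X)_ℤ] < ∞`** ⟹ `∃ n ≥ 1, n · Hdgᵖ(X, ℤ) ⊆ Dᵖ(X)_ℤ`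

— the statement "every Hodge class is a rational combination of intersections of divisors" in its integral form "some fixed multiple
of every INTEGRAL Hodge class is an INTEGRAL combination of intersections of divisor classes", instantiated in §4 for codimension `1`,
codimension `g − 1` on polarised tori, dimension `≤ 3`, and arbitrary products of elliptic curves.

## Contents (theorems only)

* §1 `divisorClasses_eq_span_range`, **`closure_divisorMonomials_le_integralHodgeClasses`** (`Dᵖ(X)_ℤ ⊆ Hdgᵖ(X, ℤ)`),
  `span_rat_closure_divisorMonomials` (`ℚ · Dᵖ(X)_ℤ = Dᵖ(X)`).
* §2 **`finrank_int_eq_finrank_span_rat_of_le_integralForms`** (any subgroup `S ⊆ Hᵏ(X, ℤ)`: `rk_ℤ S = dim_ℚ (ℚ · S)`),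
  **`finrank_closure_divisorMonomials`** (`rk_ℤ Dᵖ(X)_ℤ = dim_ℚ Dᵖ(X)`), `finrank_closure_divisorMonomials_le` (`≤ rk Hdgᵖ(X, ℤ)`).
* §3 **`divisorClasses_eq_hodgeClasses_iff_finite_quotient`**, **`exists_pos_forall_nsmul_mem_closure_divisorMonomials`**.
* §4 instances: `exists_pos_forall_nsmul_mem_closure_divisorMonomials_one` (every torus, `p = 1`),
  `IsRiemannForm.exists_pos_forall_nsmul_mem_closure_divisorMonomials_of_finrank_eq_succ` (codimension `g − 1`),
  `IsAbelianVariety.exists_pos_forall_nsmul_mem_closure_divisorMonomials_of_finrank_le_three`,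
  `exists_pos_forall_nsmul_mem_closure_divisorMonomials_pi_ellipticPeriod` (products of elliptic curves, all `p`).

## References

* [cite: Lange2023AbelianVarietiesComplex, §7.3.1 (Thm. 7.3.1 / Prop. 7.3.3, `D•(X)`); §7.3.3 Exercise (2); §7.2.2]
* [cite: vanGeemen1994HodgeAV, §2 (`Bᵖ`, `Dᵖ`) and §4 Thm. 4.3 (Tate)]
* [cite: VoisinHodgeI2002, §11.3.1 Def. 11.28 and Thm. 11.30 (PDF pp. 231–232)]
* [cite: Huybrechts2016K3, Ch. 14 §0.1 (PDF p. 333: finite-index sublattices)]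
-/

noncomputable section

open Module Function

namespace Literature.Geometry.Kaehler.ComplexTorus

section DivisorMonomials

variable {ι : Type*} {E : Type*} [NormedAddCommGroup E] [NormedSpace ℂ E] (Φ : (ι → ℝ) ≃L[ℝ] E)

/-! ## §1 `Dᵖ(X)_ℤ ⊆ Hdgᵖ(X, ℤ)` and `ℚ · Dᵖ(X)_ℤ = Dᵖ(X)` -/

/-- `Dᵖ(X)` is the `ℚ`-span of the divisor monomials (unfolding of the tree's definition). [cite: Lange2023AbelianVarietiesComplex, §7.3.1] -/
theorem divisorClasses_eq_span_range (p : ℕ) :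
    divisorClasses Φ p = Submodule.span ℚ (Set.range fun η : Fin p → neronSeveriGroup Φ ↦
      wedgeFamily p fun i ↦ ofRealForm ((η i : neronSeveriGroup Φ) : E [⋀^Fin 2]→L[ℝ] ℝ)) :=
  rfl

/-- **`Dᵖ(X)_ℤ ⊆ Hdgᵖ(X, ℤ)`**: the subgroup generated by the monomials `E₁ ∧ ⋯ ∧ E_p`, `Eᵢ ∈ NS(X)`, consists of integral Hodge
classes (each monomial is one, g31-#1 `wedgeFamily_ofRealForm_mem_integralHodgeClasses`).
[cite: VoisinHodgeI2002, §11.3.1 Def. 11.28 and Thm. 11.30] [cite: Lange2023AbelianVarietiesComplex, §7.3.1] -/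
theorem closure_divisorMonomials_le_integralHodgeClasses (p : ℕ) :
    AddSubgroup.closure (Set.range fun η : Fin p → neronSeveriGroup Φ ↦
        wedgeFamily p fun i ↦ ofRealForm ((η i : neronSeveriGroup Φ) : E [⋀^Fin 2]→L[ℝ] ℝ)) ≤
      integralHodgeClasses Φ p := by
  refine (AddSubgroup.closure_le _).2 ?_
  rintro _ ⟨η, rfl⟩
  exact wedgeFamily_ofRealForm_mem_integralHodgeClasses Φ _ fun i ↦ (mem_neronSeveriGroup_iff Φ).1 (η i).2

/-- **`ℚ · Dᵖ(X)_ℤ = Dᵖ(X)`**: the `ℚ`-span of the integral monomial lattice is the space of divisor classes.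
[cite: Lange2023AbelianVarietiesComplex, §7.3.1] [cite: vanGeemen1994HodgeAV, §2] -/
theorem span_rat_closure_divisorMonomials (p : ℕ) :
    Submodule.span ℚ ((AddSubgroup.closure (Set.range fun η : Fin p → neronSeveriGroup Φ ↦
        wedgeFamily p fun i ↦ ofRealForm ((η i : neronSeveriGroup Φ) : E [⋀^Fin 2]→L[ℝ] ℝ)) :
          AddSubgroup (E [⋀^Fin (2 * p)]→L[ℝ] ℂ)) : Set (E [⋀^Fin (2 * p)]→L[ℝ] ℂ)) = divisorClasses Φ p := by
  rw [divisorClasses_eq_span_range, ← Submodule.span_int_eq_addSubgroupClosure, Submodule.coe_toAddSubgroup,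
    Submodule.span_span_of_tower]

/-! ## §2 Ranks: `rk_ℤ S = dim_ℚ (ℚ · S)` for subgroups of the lattice; `rk_ℤ Dᵖ(X)_ℤ = dim_ℚ Dᵖ(X)` -/

/-- **`rk_ℤ S = dim_ℚ (ℚ · S)` for every subgroup `S` of the lattice `Hᵏ(X, ℤ)`**: `S` is free of finite rank and a `ℤ`-basis of `S`
is `ℚ`-linearly independent in `Hᵏ(X, ℂ)` (Mathlib's `LinearIndependent.iff_fractionRing`) and spans `ℚ · S`. (The case `S = Hdg^{k,p}(X, ℤ)`,
`ℚ · S = B^{k,p}(X)`, is g30-#9's `finrank_integralHodgeClassesIn_eq_finrank_hodgeClassesIn`.)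
[cite: Lange2023AbelianVarietiesComplex, §1.1.3 Exercise 1.1.6 (8) and §7.2.2] -/
theorem finrank_int_eq_finrank_span_rat_of_le_integralForms [Fintype ι] {k : ℕ} (S : AddSubgroup (E [⋀^Fin k]→L[ℝ] ℂ))
    (hS : S ≤ integralForms Φ k) :
    finrank ℤ S = finrank ℚ (Submodule.span ℚ (S : Set (E [⋀^Fin k]→L[ℝ] ℂ))) := by
  classical
  -- `S` is a finitely generated free abelian group (a subgroup of the lattice `Hᵏ(X, ℤ)`)
  haveI := finite_integralForms Φ k
  haveI := free_integralForms Φ k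
  let j : S →ₗ[ℤ] AddSubgroup.toIntSubmodule (integralForms Φ k) := (AddSubgroup.inclusion hS).toIntLinearMap
  have hj : Injective j := AddSubgroup.inclusion_injective hS
  haveI : Module.Finite ℤ S := Module.Finite.of_injective j hj
  haveI : Module.IsTorsionFree ℤ S := Function.Injective.moduleIsTorsionFree j hj (map_smul j)
  let b := Module.finBasis ℤ S
  let L : S →ₗ[ℤ] (E [⋀^Fin k]→L[ℝ] ℂ) := S.subtype.toIntLinearMap
  have hL : Injective L := Subtype.coe_injective
  have hgZ : LinearIndependent ℤ (L ∘ b) := b.linearIndependent.map' L (LinearMap.ker_eq_bot.2 hL)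
  have hgQ : LinearIndependent ℚ (L ∘ b) := (LinearIndependent.iff_fractionRing ℤ ℚ).1 hgZ
  have hspan : Submodule.span ℚ (Set.range (L ∘ b)) = Submodule.span ℚ (S : Set (E [⋀^Fin k]→L[ℝ] ℂ)) := by
    refine le_antisymm (Submodule.span_mono ?_) (Submodule.span_le.2 ?_)
    · rintro _ ⟨i, rfl⟩
      exact (b i).2
    · rintro γ hγ
      have hγ' : γ = L ⟨γ, hγ⟩ := rfl
      rw [hγ', ← b.sum_repr ⟨γ, hγ⟩, map_sum]
      refine Submodule.sum_mem _ fun i _ ↦ ?_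
      rw [map_smul]
      exact Submodule.smul_of_tower_mem _ _ (Submodule.subset_span ⟨i, rfl⟩)
  rw [← hspan, finrank_span_eq_card hgQ, Fintype.card_fin]

/-- **`rk_ℤ Dᵖ(X)_ℤ = dim_ℚ Dᵖ(X)`.** [cite: Lange2023AbelianVarietiesComplex, §7.3.1 and §7.2.2] [cite: vanGeemen1994HodgeAV, §2] -/
theorem finrank_closure_divisorMonomials [Fintype ι] (p : ℕ) :
    finrank ℤ (AddSubgroup.closure (Set.range fun η : Fin p → neronSeveriGroup Φ ↦
        wedgeFamily p fun i ↦ ofRealForm ((η i : neronSeveriGroup Φ) : E [⋀^Fin 2]→L[ℝ] ℝ))) =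
      finrank ℚ (divisorClasses Φ p) := by
  rw [finrank_int_eq_finrank_span_rat_of_le_integralForms Φ _
    ((closure_divisorMonomials_le_integralHodgeClasses Φ p).trans (integralHodgeClassesIn_le_integralForms Φ _ _)),
    span_rat_closure_divisorMonomials]

/-- **`rk_ℤ Dᵖ(X)_ℤ ≤ rk_ℤ Hdgᵖ(X, ℤ)`** (`dim_ℚ Dᵖ(X) ≤ dim_ℚ Bᵖ(X)`). [cite: Lange2023AbelianVarietiesComplex, §7.3.1 (`D• ⊆ H•_Hodge`) and §7.2.2] -/
theorem finrank_closure_divisorMonomials_le [Fintype ι] (p : ℕ) :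
    finrank ℤ (AddSubgroup.closure (Set.range fun η : Fin p → neronSeveriGroup Φ ↦
        wedgeFamily p fun i ↦ ofRealForm ((η i : neronSeveriGroup Φ) : E [⋀^Fin 2]→L[ℝ] ℝ))) ≤
      finrank ℤ (integralHodgeClasses Φ p) := by
  haveI : FiniteDimensional ℚ (hodgeClasses Φ p) := finiteDimensional_hodgeClassesIn Φ (2 * p) p
  rw [finrank_closure_divisorMonomials, finrank_integralHodgeClasses_eq_finrank_hodgeClasses]
  exact Submodule.finrank_mono (divisorClasses_le_hodgeClasses Φ p)

/-! ## §3 `Dᵖ(X) = Bᵖ(X)` iff `Dᵖ(X)_ℤ` has finite index in `Hdgᵖ(X, ℤ)` -/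

/-- **`Dᵖ(X) = Bᵖ(X)` ⟺ `Dᵖ(X)_ℤ ⊆ Hdgᵖ(X, ℤ)` has finite index** (`[Hdgᵖ(X, ℤ) : Dᵖ(X)_ℤ] < ∞`): both are free abelian groups with
`ℚ`-spans `Dᵖ(X) ⊆ Bᵖ(X)`, and a sublattice has finite index iff the ranks agree (Mathlib's `Submodule.finiteQuotient_iff`).
[cite: Lange2023AbelianVarietiesComplex, §7.3.1 and §7.2.2] [cite: vanGeemen1994HodgeAV, §2] [cite: Huybrechts2016K3, Ch. 14 §0.1 (PDF p. 333)] -/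
theorem divisorClasses_eq_hodgeClasses_iff_finite_quotient [Fintype ι] (p : ℕ) :
    divisorClasses Φ p = hodgeClasses Φ p ↔
      Finite (integralHodgeClasses Φ p ⧸ AddSubgroup.toIntSubmodule ((AddSubgroup.closure
        (Set.range fun η : Fin p → neronSeveriGroup Φ ↦
          wedgeFamily p fun i ↦ ofRealForm ((η i : neronSeveriGroup Φ) : E [⋀^Fin 2]→L[ℝ] ℝ))).addSubgroupOf
            (integralHodgeClasses Φ p))) := by
  haveI := moduleFree_integralHodgeClasses Φ p
  haveI := moduleFinite_integralHodgeClasses Φ p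
  haveI : FiniteDimensional ℚ (hodgeClasses Φ p) := finiteDimensional_hodgeClassesIn Φ (2 * p) p
  set D := AddSubgroup.closure (Set.range fun η : Fin p → neronSeveriGroup Φ ↦
    wedgeFamily p fun i ↦ ofRealForm ((η i : neronSeveriGroup Φ) : E [⋀^Fin 2]→L[ℝ] ℝ)) with hD
  have hle : D ≤ integralHodgeClasses Φ p := closure_divisorMonomials_le_integralHodgeClasses Φ p
  have hrk : finrank ℤ (AddSubgroup.toIntSubmodule (D.addSubgroupOf (integralHodgeClasses Φ p))) = finrank ℤ D :=
    (AddSubgroup.addSubgroupOfEquivOfLe hle).toIntLinearEquiv.finrank_eq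
  rw [Submodule.finiteQuotient_iff, hrk, hD, finrank_closure_divisorMonomials, finrank_integralHodgeClasses_eq_finrank_hodgeClasses]
  exact ⟨fun h ↦ by rw [h], fun h ↦ Submodule.eq_of_le_of_finrank_eq (divisorClasses_le_hodgeClasses Φ p) h⟩

/-- **`Dᵖ(X) = Bᵖ(X)` ⟹ `∃ n ≥ 1, n · Hdgᵖ(X, ℤ) ⊆ Dᵖ(X)_ℤ`**: when every Hodge class is a rational combination of intersections of
divisors, ONE positive integer `n` multiplies every INTEGRAL Hodge class of codimension `p` into an INTEGRAL combination of monomials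
`E₁ ∧ ⋯ ∧ E_p`, `Eᵢ ∈ NS(X)` (`n` = the index `[Hdgᵖ(X, ℤ) : Dᵖ(X)_ℤ]`).
[cite: Lange2023AbelianVarietiesComplex, §7.3.1 and §7.2.2] [cite: vanGeemen1994HodgeAV, §2] -/
theorem exists_pos_forall_nsmul_mem_closure_divisorMonomials [Fintype ι] {p : ℕ} (h : divisorClasses Φ p = hodgeClasses Φ p) :
    ∃ n : ℕ, 0 < n ∧ ∀ γ ∈ integralHodgeClasses Φ p,
      n • γ ∈ AddSubgroup.closure (Set.range fun η : Fin p → neronSeveriGroup Φ ↦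
        wedgeFamily p fun i ↦ ofRealForm ((η i : neronSeveriGroup Φ) : E [⋀^Fin 2]→L[ℝ] ℝ)) := by
  set D := AddSubgroup.closure (Set.range fun η : Fin p → neronSeveriGroup Φ ↦
    wedgeFamily p fun i ↦ ofRealForm ((η i : neronSeveriGroup Φ) : E [⋀^Fin 2]→L[ℝ] ℝ)) with hD
  have hfin := (divisorClasses_eq_hodgeClasses_iff_finite_quotient Φ p).1 h
  haveI : Finite (integralHodgeClasses Φ p ⧸
      (AddSubgroup.toIntSubmodule (D.addSubgroupOf (integralHodgeClasses Φ p))).toAddSubgroup) := hfin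
  refine ⟨(AddSubgroup.toIntSubmodule (D.addSubgroupOf (integralHodgeClasses Φ p))).toAddSubgroup.index,
    Nat.pos_of_ne_zero AddSubgroup.index_ne_zero_of_finite, fun γ hγ ↦ ?_⟩
  have hmem := AddSubgroup.nsmul_index_mem
    (AddSubgroup.toIntSubmodule (D.addSubgroupOf (integralHodgeClasses Φ p))).toAddSubgroup ⟨γ, hγ⟩
  exact hmem

/-! ## §4 Instances where the tree proves `Dᵖ = Bᵖ` -/

/-- **Codimension `1`, every complex torus** (Lefschetz `(1,1)`: `D¹(X) = B¹(X)`, the tree's `divisorClasses_one_eq_hodgeClasses`):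
`n · Hdg¹(X, ℤ) ⊆ ⟨NS(X)⟩_ℤ` for some `n ≥ 1` (in fact `Hdg¹(X, ℤ) = NS(X)`, the tree's `integralHodgeClasses_one_eq_map_neronSeveriGroup`).
[cite: Lange2023AbelianVarietiesComplex, §1.3.1 and §7.3.3 Exercise (2)(a)] -/
theorem exists_pos_forall_nsmul_mem_closure_divisorMonomials_one [Fintype ι] :
    ∃ n : ℕ, 0 < n ∧ ∀ γ ∈ integralHodgeClasses Φ 1,
      n • γ ∈ AddSubgroup.closure (Set.range fun η : Fin 1 → neronSeveriGroup Φ ↦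
        wedgeFamily 1 fun i ↦ ofRealForm ((η i : neronSeveriGroup Φ) : E [⋀^Fin 2]→L[ℝ] ℝ)) :=
  exists_pos_forall_nsmul_mem_closure_divisorMonomials Φ (divisorClasses_one_eq_hodgeClasses Φ)

/-- **Codimension `g − 1` on a polarised torus** (the `(n−1,n−1)` theorem, Lange §7.3.3 Exercise (2)(b); the tree's
`IsRiemannForm.divisorClasses_eq_hodgeClasses_of_finrank_eq_succ`): some `n ≥ 1` multiplies every integral curve class `γ ∈ Hdg^{g−1}(X, ℤ)`
into an integral combination of monomials `E₁ ∧ ⋯ ∧ E_{g−1}`. [cite: Lange2023AbelianVarietiesComplex, §7.3.3 Exercise (2)(b)] -/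
theorem IsRiemannForm.exists_pos_forall_nsmul_mem_closure_divisorMonomials_of_finrank_eq_succ [Fintype ι] [FiniteDimensional ℂ E]
    {η₀ : E [⋀^Fin 2]→L[ℝ] ℝ} (hη₀ : IsRiemannForm Φ η₀) {p : ℕ} (hg : finrank ℂ E = p + 1) :
    ∃ n : ℕ, 0 < n ∧ ∀ γ ∈ integralHodgeClasses Φ p,
      n • γ ∈ AddSubgroup.closure (Set.range fun η : Fin p → neronSeveriGroup Φ ↦
        wedgeFamily p fun i ↦ ofRealForm ((η i : neronSeveriGroup Φ) : E [⋀^Fin 2]→L[ℝ] ℝ)) :=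
  ComplexTorus.exists_pos_forall_nsmul_mem_closure_divisorMonomials Φ (hη₀.divisorClasses_eq_hodgeClasses_of_finrank_eq_succ Φ hg)

/-- **Abelian varieties of dimension `≤ 3`, every codimension** (the tree's
`divisorClasses_eq_hodgeClasses_of_isAbelianVariety_of_finrank_le_three`). [cite: Lange2023AbelianVarietiesComplex, §7.3.3 Exercise (2)(c)] -/
theorem IsAbelianVariety.exists_pos_forall_nsmul_mem_closure_divisorMonomials_of_finrank_le_three [Fintype ι]
    [FiniteDimensional ℂ E] (hX : IsAbelianVariety Φ) (h3 : finrank ℂ E ≤ 3) (p : ℕ) :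
    ∃ n : ℕ, 0 < n ∧ ∀ γ ∈ integralHodgeClasses Φ p,
      n • γ ∈ AddSubgroup.closure (Set.range fun η : Fin p → neronSeveriGroup Φ ↦
        wedgeFamily p fun i ↦ ofRealForm ((η i : neronSeveriGroup Φ) : E [⋀^Fin 2]→L[ℝ] ℝ)) :=
  exists_pos_forall_nsmul_mem_closure_divisorMonomials Φ
    (divisorClasses_eq_hodgeClasses_of_isAbelianVariety_of_finrank_le_three Φ h3 hX p)

/-- **Products of elliptic curves `E_{σ₀} × ⋯ × E_{σ_{N−1}}`, every codimension** (Tate's theorem at torus level, the tree's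
`divisorClasses_eq_hodgeClasses_pi_ellipticPeriod`; van Geemen 1994 Thm. 4.3): some `n ≥ 1` multiplies every integral Hodge class into
an integral combination of intersections of divisor classes. [cite: vanGeemen1994HodgeAV, §4 Thm. 4.3 (Tate)] -/
theorem exists_pos_forall_nsmul_mem_closure_divisorMonomials_pi_ellipticPeriod {N : ℕ} {σ : Fin N → ℂ}
    (hσ : ∀ k, (σ k).im ≠ 0) (p : ℕ) :
    ∃ n : ℕ, 0 < n ∧ ∀ γ ∈ integralHodgeClasses (piPeriod fun k : Fin N ↦ ellipticPeriod (hσ k)) p,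
      n • γ ∈ AddSubgroup.closure (Set.range fun η : Fin p → neronSeveriGroup (piPeriod fun k : Fin N ↦ ellipticPeriod (hσ k)) ↦
        wedgeFamily p fun i ↦ ofRealForm
          ((η i : neronSeveriGroup (piPeriod fun k : Fin N ↦ ellipticPeriod (hσ k))) : (Fin N → ℂ) [⋀^Fin 2]→L[ℝ] ℝ)) :=
  exists_pos_forall_nsmul_mem_closure_divisorMonomials _ (divisorClasses_eq_hodgeClasses_pi_ellipticPeriod hσ p)

end DivisorMonomials

end Literature.Geometry.Kaehler.ComplexTorus
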